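import Summits.AtomisticToContinuum.Crystallization.Theorems.ChartedZeroExcessLayeredLatticeLiouvilleZZG
import Literature.Geometry.DiscreteGeometry.KissingRigidity

/-!
# Part ZZH «ConePins — certificate machinery» (lens-2 g80; (B′.3b) of the REACH DESIGN, critic rows 1447 (B)(3) / 1454)

The direction quantifier of the cone pin («for EVERY outward direction `w` the cone members pin the site») is DECIDABLE.  This rider supplies the
generic machinery; Part ZZI supplies the data (one quadtree per letter context and cube face) and the `decide`s.

* §1 THE IDEAL INTEGER EMBEDDING `iota ℓ : ℤ × ℤ × ℤ → ℤ³` of relative index sites, in units `1/√18` (the frame of `Literature…hcpInt`): in-sheet basis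
  `E₁ = (3,−3,0)`, `E₂ = (3,0,−3)`, hollow step `±(2,−1,−1)` per letter (`hol`), sheet step `(2,2,2)`; every Barlow site of the five-sheet window is an
  INTEGER vector (`sqNormInt_iota_shell1`: the twelve link sites have squared norm `18`).  Cap tests in `ℤ`: `capZB num den v c` ⟺ `⟪v,c⟫ ≥ 0 ∧
  den·⟪v,c⟫² ≥ num·|v|²|c|²`, with its real meaning `inner_ge_of_capZB` (`√(num/den)·‖v‖‖c‖ ≤ ⟪v, c⟫` for the points `intVec v`, `intVec c` of `ℝ³`).
* §2 CELLS: for a list `cs` of integer «corner» vectors, the member lists `cellSigma1` (first shell, cos ≥ 5/9 to every corner), `cellSigma2` (second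
  shell, cos ≥ 11/20), the allowed competitors `cellAllowed` (CLASS-SPLIT, matching the metric budget of Part ZZJ: DOUBLES — two-step sites of squared norm
  `72 = (2 bonds)²` within `45°` of every corner (`capZB 1 2`) — and APEXES — squared norm `48 = (4/√6 bonds)²` within `arccos √(5/9) ≈ 41.81°`
  (`capZB 5 9`); nothing else), the cell test `cellCheckB a b c d cs := pinCheckB …` (Part ZZG) and its soundness `cell_sound`.
* §3 QUADTREES `QT` over dyadic boxes `[i, i+1] × [j, j+1] / 2ⁿ ⊆ [0,1]²` with the Bool fold `QT.okB` and the real-coordinates COVERING LEMMA `QT.cover` (a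
  passing tree over a box yields, for every real point of the box, a passing LEAF box containing it).
* §4 FACE GEOMETRY: integer / real face vectors `faceZ` / `faceR` on the cube face `ax = ±2ⁿ` (`intVec_faceZ`), the corner list `corners`, the face test
  `faceTest`, bilinearity `faceR_bilinear` (any step), scaling, `faceR_self` (every vector is a face vector of its own coordinates) and CONE CONVEXITY
  `inner_ge_of_cone4` (a cap condition against four generators holds against every non-negative combination).

0 sorry.  Consumer: Part ZZI `pin_certificate`.
-/

open scoped RealInnerProductSpace
open Literature.Geometry.DiscreteGeometry (intVec intVec_apply norm_intVec sqNormInt dotInt)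

namespace Summit.AtomisticToContinuum.Crystallization.Theorems.ChartedZeroExcessLayeredLatticeLiouville

open Summit.AtomisticToContinuum.Crystallization.Theorems.ChartedPlanarOrderRigidityDoor (E3)

/-! ## ZZH-1  The ideal integer embedding and integer cap tests -/

/-- the sign `±1` of a letter (`true ↦ +1`: the hollow offset advances by `+(2,−1,−1)`). [this file, g80] -/
def bsgn (b : Bool) : ℤ := if b then 1 else -1

/-- net hollow count of sheet `k ∈ {−2,…,2}` relative to sheet `0`, for the letter function `ℓ`. [this file, g80] -/
def hol (ℓ : ℤ → Bool) (k : ℤ) : ℤ :=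
  if k = 1 then bsgn (ℓ 0) else if k = 2 then bsgn (ℓ 0) + bsgn (ℓ 1)
  else if k = -1 then -bsgn (ℓ (-1)) else if k = -2 then -bsgn (ℓ (-1)) - bsgn (ℓ (-2)) else 0

/-- ★ THE IDEAL INTEGER EMBEDDING (units `1/√18`): site `(k, i, j) ↦ i·(3,−3,0) + j·(3,0,−3) + hol·(2,−1,−1) + k·(2,2,2)`. [this file, g80] -/
def iota (ℓ : ℤ → Bool) (z : ℤ × ℤ × ℤ) : Fin 3 → ℤ :=
  ![3 * z.2.1 + 3 * z.2.2 + 2 * hol ℓ z.1 + 2 * z.1, -3 * z.2.1 - hol ℓ z.1 + 2 * z.1, -3 * z.2.2 - hol ℓ z.1 + 2 * z.1]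

/-- sanity: the twelve link sites of the origin embed at squared norm `18` (one bond), in every letter context. [this file, g80] -/
theorem sqNormInt_iota_shell1 : ∀ a b c d : Bool, ∀ i : Fin 12,
    sqNormInt (iota (letters4 a b c d) (linkPt (letters4 a b c d) 0 i)) = 18 := by decide

/-- ★ INTEGER CAP TEST: `⟪v, c⟫ ≥ 0` and `den·⟪v,c⟫² ≥ num·|v|²·|c|²` (cosine at least `√(num/den)`). [this file, g80] -/
def capZB (num den : ℕ) (v c : Fin 3 → ℤ) : Bool :=
  decide (0 ≤ dotInt v c) && decide ((num : ℤ) * (sqNormInt v * sqNormInt c) ≤ (den : ℤ) * (dotInt v c * dotInt v c))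

/-- [formal bookkeeping] (lane edit hand-2 g39: ONE `private` token — `dedup.landed` vs
`Literature.Barriers.AtomisticToContinuum.sqNormInt_nonneg`; body verbatim.) -/
private theorem sqNormInt_cast_nonneg (v : Fin 3 → ℤ) : (0 : ℝ) ≤ (sqNormInt v : ℝ) := by
  have : (0 : ℤ) ≤ sqNormInt v := by unfold sqNormInt; positivity
  exact_mod_cast this

/-- ★ REAL MEANING of the integer cap test: `√(num/den) · ‖v‖ ‖c‖ ≤ ⟪v, c⟫` for the integer points. [this file, g80] -/
theorem inner_ge_of_capZB {num den : ℕ} (hden : 0 < den) {v c : Fin 3 → ℤ} (h : capZB num den v c = true) :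
    Real.sqrt (num / den) * (‖intVec v‖ * ‖intVec c‖) ≤ ⟪intVec v, intVec c⟫ := by
  simp only [capZB, Bool.and_eq_true, decide_eq_true_eq] at h
  obtain ⟨h0, h1⟩ := h
  rw [Literature.Geometry.DiscreteGeometry.inner_intVec, norm_intVec, norm_intVec]
  have hD : (0 : ℝ) ≤ (dotInt v c : ℝ) := by exact_mod_cast h0
  have h1' : (num : ℝ) * ((sqNormInt v : ℝ) * (sqNormInt c : ℝ)) ≤ (den : ℝ) * ((dotInt v c : ℝ) * (dotInt v c : ℝ)) := by
    exact_mod_cast h1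
  have hden' : (0 : ℝ) < (den : ℝ) := by exact_mod_cast hden
  have key : (num : ℝ) / den * ((sqNormInt v : ℝ) * (sqNormInt c : ℝ)) ≤ (dotInt v c : ℝ) * (dotInt v c : ℝ) := by
    rw [div_mul_eq_mul_div, div_le_iff₀ hden']; linarith
  calc Real.sqrt (num / den) * (Real.sqrt (sqNormInt v : ℝ) * Real.sqrt (sqNormInt c : ℝ))
      = Real.sqrt ((num : ℝ) / den * ((sqNormInt v : ℝ) * (sqNormInt c : ℝ))) := by
        rw [Real.sqrt_mul (by positivity), Real.sqrt_mul (sqNormInt_cast_nonneg v)]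
    _ ≤ Real.sqrt ((dotInt v c : ℝ) * (dotInt v c : ℝ)) := Real.sqrt_le_sqrt key
    _ = (dotInt v c : ℝ) := Real.sqrt_mul_self hD

/-! ## ZZH-2  Cells: members, allowed competitors, the cell test and its soundness -/

/-- the twelve first-shell sites of the origin. [this file, g80] -/
def shell1 (ℓ : ℤ → Bool) : List (ℤ × ℤ × ℤ) := (List.finRange 12).map (linkPt ℓ 0)

/-- the sites within two steps of the origin (with repetitions). [this file, g80] -/
def twoStep (ℓ : ℤ → Bool) : List (ℤ × ℤ × ℤ) :=
  (List.finRange 12).flatMap fun i => (List.finRange 12).map fun j => linkPt ℓ (linkPt ℓ 0 i) j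

/-- the second-shell sites of the origin: two-step sites at squared norm `36 = (√2 bonds)²`. [this file, g80] -/
def shell2 (ℓ : ℤ → Bool) : List (ℤ × ℤ × ℤ) := (twoStep ℓ).filter fun z => decide (sqNormInt (iota ℓ z) = 36)

/-- first-shell members of a cell: cosine at least `5/9` to every corner. [this file, g80] -/
def cellSigma1 (ℓ : ℤ → Bool) (cs : List (Fin 3 → ℤ)) : List (ℤ × ℤ × ℤ) :=
  (shell1 ℓ).filter fun s => cs.all fun c => capZB 25 81 (iota ℓ s) c

/-- second-shell members of a cell: cosine at least `11/20` to every corner. [this file, g80] -/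
def cellSigma2 (ℓ : ℤ → Bool) (cs : List (Fin 3 → ℤ)) : List (ℤ × ℤ × ℤ) :=
  (shell2 ℓ).filter fun s => cs.all fun c => capZB 121 400 (iota ℓ s) c

/-- allowed competitors of a cell, split by class (the two classes that survive the member relations, and the only two Part ZZJ localises):
DOUBLES `z = 2m` (squared norm `72`) within `45°` of every corner, APEXES `ι z = ±(4,4,4)` (squared norm `48`) within `arccos √(5/9) ≈ 41.81°` of every
corner; no other site is allowed. [this file, g80] -/
def cellAllowed (ℓ : ℤ → Bool) (cs : List (Fin 3 → ℤ)) : List (ℤ × ℤ × ℤ) :=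
  (twoStep ℓ).filter fun z =>
    (decide (sqNormInt (iota ℓ z) = 72) && cs.all fun c => capZB 1 2 (iota ℓ z) c) ||
    (decide (sqNormInt (iota ℓ z) = 48) && cs.all fun c => capZB 5 9 (iota ℓ z) c)

/-- ★ THE CELL TEST: the pin checker of Part ZZG on the cell's member / allowed lists. [this file, g80] -/
def cellCheckB (a b c d : Bool) (cs : List (Fin 3 → ℤ)) : Bool :=
  pinCheckB a b c d (cellSigma1 (letters4 a b c d) cs) (cellSigma2 (letters4 a b c d) cs) (cellAllowed (letters4 a b c d) cs)

/-- [formal bookkeeping] -/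
theorem mem_shell1 {ℓ : ℤ → Bool} {s : ℤ × ℤ × ℤ} : s ∈ shell1 ℓ ↔ ∃ i, s = linkPt ℓ 0 i := by
  simp [shell1, eq_comm]

/-- [formal bookkeeping] -/
theorem mem_twoStep {ℓ : ℤ → Bool} {z : ℤ × ℤ × ℤ} : z ∈ twoStep ℓ ↔ ∃ i j, z = linkPt ℓ (linkPt ℓ 0 i) j := by
  simp [twoStep, eq_comm]

/-- first-shell sites lie on sheets `−1, 0, 1`. [formal bookkeeping] -/
theorem shell1_fst (ℓ : ℤ → Bool) : ∀ s ∈ shell1 ℓ, -1 ≤ s.1 ∧ s.1 ≤ 1 := by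
  intro s hs
  obtain ⟨i, rfl⟩ := mem_shell1.1 hs
  simp only [linkPt_fst, Prod.fst_zero]
  have h3 := linkSite_fst (ℓ (0 - 1)) (ℓ 0) i
  omega

/-- second-shell sites lie on sheets `−1, 0, 1`. [formal bookkeeping] -/
theorem shell2_fst : ∀ a b c d : Bool, ∀ s ∈ shell2 (letters4 a b c d), -1 ≤ s.1 ∧ s.1 ≤ 1 := by decide

/-- [formal bookkeeping] -/
theorem mem_cellSigma1 {ℓ : ℤ → Bool} {cs : List (Fin 3 → ℤ)} {s : ℤ × ℤ × ℤ} :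
    s ∈ cellSigma1 ℓ cs ↔ s ∈ shell1 ℓ ∧ ∀ c ∈ cs, capZB 25 81 (iota ℓ s) c = true := by
  simp [cellSigma1, List.all_eq_true]

/-- [formal bookkeeping] -/
theorem mem_cellSigma2 {ℓ : ℤ → Bool} {cs : List (Fin 3 → ℤ)} {s : ℤ × ℤ × ℤ} :
    s ∈ cellSigma2 ℓ cs ↔ s ∈ shell2 ℓ ∧ ∀ c ∈ cs, capZB 121 400 (iota ℓ s) c = true := by
  simp [cellSigma2, List.all_eq_true]

/-- [formal bookkeeping] -/
theorem mem_cellAllowed {ℓ : ℤ → Bool} {cs : List (Fin 3 → ℤ)} {z : ℤ × ℤ × ℤ} :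
    z ∈ cellAllowed ℓ cs ↔ z ∈ twoStep ℓ ∧
      ((sqNormInt (iota ℓ z) = 72 ∧ ∀ c ∈ cs, capZB 1 2 (iota ℓ z) c = true) ∨
       (sqNormInt (iota ℓ z) = 48 ∧ ∀ c ∈ cs, capZB 5 9 (iota ℓ z) c = true)) := by
  simp [cellAllowed, List.all_eq_true]

/-- ★★ SOUNDNESS OF THE CELL TEST: a site adjacent to all first-shell members of a passing cell and `BarlowFour`-related to all its second-shell
members is the origin or an allowed competitor — for every letter function agreeing with the context on `{−2,…,1}`. [this file, g80] -/
theorem cell_sound {a b c d : Bool} {cs : List (Fin 3 → ℤ)} (h : cellCheckB a b c d cs = true) {ℓ : ℤ → Bool}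
    (hℓ : ∀ m : ℤ, -2 ≤ m → m ≤ 1 → ℓ m = letters4 a b c d m) {x : ℤ × ℤ × ℤ}
    (h1 : ∀ m ∈ cellSigma1 (letters4 a b c d) cs, BarlowAdj ℓ x m)
    (h2 : ∀ m' ∈ cellSigma2 (letters4 a b c d) cs, BarlowFour ℓ x m') :
    x = 0 ∨ x ∈ cellAllowed (letters4 a b c d) cs :=
  pin_sound h (fun m hm => shell1_fst _ m (mem_cellSigma1.1 hm).1) (fun m hm => shell2_fst a b c d m (mem_cellSigma2.1 hm).1) hℓ h1 h2

/-! ## ZZH-3  Quadtrees over dyadic boxes and the covering lemma -/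

/-- a quadtree shape (the certificate data: which boxes are subdivided). [this file, g80] -/
inductive QT : Type
  | leaf : QT
  | node : QT → QT → QT → QT → QT

/-- the Bool fold of a quadtree over the dyadic box `(n, i, j) = [i, i+1] × [j, j+1] / 2ⁿ`: every leaf box passes `test`; the children of `(n, i, j)`
are `(n+1, 2i + δ, 2j + δ')`. [this file, g80] -/
def QT.okB (test : ℕ → ℤ → ℤ → Bool) : QT → ℕ → ℤ → ℤ → Bool
  | .leaf, n, i, j => test n i j
  | .node t₁ t₂ t₃ t₄, n, i, j =>
      t₁.okB test (n + 1) (2 * i) (2 * j) && t₂.okB test (n + 1) (2 * i + 1) (2 * j) &&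
        t₃.okB test (n + 1) (2 * i) (2 * j + 1) && t₄.okB test (n + 1) (2 * i + 1) (2 * j + 1)

/-- the real box `(n, i, j)`: points `p` with `p·2ⁿ ∈ [i, i+1] × [j, j+1]`. [this file, g80] -/
def InBox (n : ℕ) (i j : ℤ) (p : ℝ × ℝ) : Prop :=
  (i : ℝ) ≤ p.1 * 2 ^ n ∧ p.1 * 2 ^ n ≤ i + 1 ∧ (j : ℝ) ≤ p.2 * 2 ^ n ∧ p.2 * 2 ^ n ≤ j + 1

/-- ★ COVERING LEMMA: a passing tree over a box gives every point of the box a passing leaf box containing it. [this file, g80] -/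
theorem QT.cover (test : ℕ → ℤ → ℤ → Bool) : ∀ (t : QT) (n : ℕ) (i j : ℤ), t.okB test n i j = true →
    ∀ p : ℝ × ℝ, InBox n i j p → ∃ n' i' j', test n' i' j' = true ∧ InBox n' i' j' p
  | .leaf, n, i, j, h, p, hp => ⟨n, i, j, h, hp⟩
  | .node t₁ t₂ t₃ t₄, n, i, j, h, p, hp => by
      simp only [QT.okB, Bool.and_eq_true] at h
      obtain ⟨⟨⟨h₁, h₂⟩, h₃⟩, h₄⟩ := h
      obtain ⟨hx1, hx2, hy1, hy2⟩ := hp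
      have ex : p.1 * 2 ^ (n + 1) = 2 * (p.1 * 2 ^ n) := by rw [pow_succ]; ring
      have ey : p.2 * 2 ^ (n + 1) = 2 * (p.2 * 2 ^ n) := by rw [pow_succ]; ring
      by_cases hx : p.1 * 2 ^ n ≤ i + 1 / 2 <;> by_cases hy : p.2 * 2 ^ n ≤ j + 1 / 2
      · exact QT.cover test t₁ (n + 1) (2 * i) (2 * j) h₁ p
          ⟨by push_cast; linarith, by push_cast; linarith, by push_cast; linarith, by push_cast; linarith⟩
      · exact QT.cover test t₃ (n + 1) (2 * i) (2 * j + 1) h₃ p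
          ⟨by push_cast; linarith, by push_cast; linarith, by push_cast; linarith, by push_cast; linarith⟩
      · exact QT.cover test t₂ (n + 1) (2 * i + 1) (2 * j) h₂ p
          ⟨by push_cast; linarith, by push_cast; linarith, by push_cast; linarith, by push_cast; linarith⟩
      · exact QT.cover test t₄ (n + 1) (2 * i + 1) (2 * j + 1) h₄ p
          ⟨by push_cast; linarith, by push_cast; linarith, by push_cast; linarith, by push_cast; linarith⟩

/-! ## ZZH-4  Face geometry: corners, bilinearity, cone convexity -/

/-- the integer vector on the cube face `ax`: coordinate `ax` is `s`, the next coordinate `a`, the remaining one `b`. [this file, g80] -/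
def faceZ (ax : Fin 3) (s a b : ℤ) : Fin 3 → ℤ := fun k => if k = ax then s else if k = ax + 1 then a else b

/-- the real vector on the cube face `ax` (same convention). [this file, g80] -/
noncomputable def faceR (ax : Fin 3) (s a b : ℝ) : E3 := WithLp.toLp 2 fun k => if k = ax then s else if k = ax + 1 then a else b

/-- [formal bookkeeping] -/
theorem faceR_apply (ax : Fin 3) (s a b : ℝ) (k : Fin 3) : faceR ax s a b k = if k = ax then s else if k = ax + 1 then a else b := rfl

/-- [formal bookkeeping] -/
theorem intVec_faceZ (ax : Fin 3) (s a b : ℤ) : intVec (faceZ ax s a b) = faceR ax s a b := by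
  ext k
  rw [intVec_apply, faceR_apply, faceZ]
  split_ifs <;> simp

/-- the four integer corners of the dyadic box `(n, i, j) ⊆ [0,1]²` drawn on the cube face `ax = ±2ⁿ` (`sg = true`: `+`): the box point
`p` is the direction with face coordinates `(2p₁ − 1, 2p₂ − 1) ∈ [−1,1]²`, so the corners are `(±2ⁿ; 2i − 2ⁿ + 2δ, 2j − 2ⁿ + 2δ')`. [this file, g80] -/
def corners (ax : Fin 3) (sg : Bool) (n : ℕ) (i j : ℤ) : List (Fin 3 → ℤ) :=
  [faceZ ax (if sg then 2 ^ n else -2 ^ n) (2 * i - 2 ^ n) (2 * j - 2 ^ n),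
    faceZ ax (if sg then 2 ^ n else -2 ^ n) (2 * i - 2 ^ n + 2) (2 * j - 2 ^ n),
    faceZ ax (if sg then 2 ^ n else -2 ^ n) (2 * i - 2 ^ n) (2 * j - 2 ^ n + 2),
    faceZ ax (if sg then 2 ^ n else -2 ^ n) (2 * i - 2 ^ n + 2) (2 * j - 2 ^ n + 2)]

/-- ★ THE FACE TEST of a dyadic box: the cell test on its four corners. [this file, g80] -/
def faceTest (a b c d : Bool) (ax : Fin 3) (sg : Bool) (n : ℕ) (i j : ℤ) : Bool := cellCheckB a b c d (corners ax sg n i j)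

/-- every vector is the face vector of its own coordinates (for any axis). [formal bookkeeping] -/
theorem faceR_self (w : E3) (ax : Fin 3) : faceR ax (w ax) (w (ax + 1)) (w (ax + 2)) = w := by
  ext k
  rw [faceR_apply]
  fin_cases ax <;> fin_cases k <;> simp

/-- face vectors scale. [formal bookkeeping] -/
theorem faceR_smul (ax : Fin 3) (r s a b : ℝ) : faceR ax (r * s) (r * a) (r * b) = r • faceR ax s a b := by
  ext k
  rw [PiLp.smul_apply, faceR_apply, faceR_apply, smul_eq_mul]
  split_ifs <;> rfl

/-- ★ BILINEARITY: a face vector over the box `[i, i+h] × [j, j+h]` (`h ≠ 0`) is the bilinear combination of the four corner vectors.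
[this file, g80] -/
theorem faceR_bilinear (ax : Fin 3) (s i j a b : ℝ) {h : ℝ} (hh : h ≠ 0) :
    faceR ax s a b = ((i + h - a) * (j + h - b) / h ^ 2) • faceR ax s i j + ((a - i) * (j + h - b) / h ^ 2) • faceR ax s (i + h) j +
      ((i + h - a) * (b - j) / h ^ 2) • faceR ax s i (j + h) + ((a - i) * (b - j) / h ^ 2) • faceR ax s (i + h) (j + h) := by
  ext k
  simp only [PiLp.add_apply, PiLp.smul_apply, faceR_apply, smul_eq_mul]
  split_ifs <;> field_simp <;> ring

/-- ★ CONE CONVEXITY: a cap condition `t‖v‖‖C‖ ≤ ⟪v, C⟫` against four generators holds against every non-negative combination. [this file, g80] -/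
theorem inner_ge_of_cone4 {v C₁ C₂ C₃ C₄ : E3} {t μ₁ μ₂ μ₃ μ₄ : ℝ} (ht : 0 ≤ t)
    (h₁ : t * (‖v‖ * ‖C₁‖) ≤ ⟪v, C₁⟫) (h₂ : t * (‖v‖ * ‖C₂‖) ≤ ⟪v, C₂⟫) (h₃ : t * (‖v‖ * ‖C₃‖) ≤ ⟪v, C₃⟫)
    (h₄ : t * (‖v‖ * ‖C₄‖) ≤ ⟪v, C₄⟫) (hμ₁ : 0 ≤ μ₁) (hμ₂ : 0 ≤ μ₂) (hμ₃ : 0 ≤ μ₃) (hμ₄ : 0 ≤ μ₄) :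
    t * (‖v‖ * ‖μ₁ • C₁ + μ₂ • C₂ + μ₃ • C₃ + μ₄ • C₄‖) ≤ ⟪v, μ₁ • C₁ + μ₂ • C₂ + μ₃ • C₃ + μ₄ • C₄⟫ := by
  have hn : ‖μ₁ • C₁ + μ₂ • C₂ + μ₃ • C₃ + μ₄ • C₄‖ ≤ μ₁ * ‖C₁‖ + μ₂ * ‖C₂‖ + μ₃ * ‖C₃‖ + μ₄ * ‖C₄‖ := by
    have e₁ : ‖μ₁ • C₁‖ = μ₁ * ‖C₁‖ := by rw [norm_smul, Real.norm_of_nonneg hμ₁]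
    have e₂ : ‖μ₂ • C₂‖ = μ₂ * ‖C₂‖ := by rw [norm_smul, Real.norm_of_nonneg hμ₂]
    have e₃ : ‖μ₃ • C₃‖ = μ₃ * ‖C₃‖ := by rw [norm_smul, Real.norm_of_nonneg hμ₃]
    have e₄ : ‖μ₄ • C₄‖ = μ₄ * ‖C₄‖ := by rw [norm_smul, Real.norm_of_nonneg hμ₄]
    calc ‖μ₁ • C₁ + μ₂ • C₂ + μ₃ • C₃ + μ₄ • C₄‖ ≤ ‖μ₁ • C₁ + μ₂ • C₂ + μ₃ • C₃‖ + ‖μ₄ • C₄‖ := norm_add_le _ _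
      _ ≤ ‖μ₁ • C₁ + μ₂ • C₂‖ + ‖μ₃ • C₃‖ + ‖μ₄ • C₄‖ := by gcongr; exact norm_add_le _ _
      _ ≤ ‖μ₁ • C₁‖ + ‖μ₂ • C₂‖ + ‖μ₃ • C₃‖ + ‖μ₄ • C₄‖ := by gcongr; exact norm_add_le _ _
      _ = _ := by rw [e₁, e₂, e₃, e₄]
  rw [inner_add_right, inner_add_right, inner_add_right, inner_smul_right, inner_smul_right, inner_smul_right,
    inner_smul_right]
  have hv : 0 ≤ t * ‖v‖ := mul_nonneg ht (norm_nonneg v)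
  calc t * (‖v‖ * ‖μ₁ • C₁ + μ₂ • C₂ + μ₃ • C₃ + μ₄ • C₄‖) = (t * ‖v‖) * ‖μ₁ • C₁ + μ₂ • C₂ + μ₃ • C₃ + μ₄ • C₄‖ := by ring
    _ ≤ (t * ‖v‖) * (μ₁ * ‖C₁‖ + μ₂ * ‖C₂‖ + μ₃ * ‖C₃‖ + μ₄ * ‖C₄‖) := by gcongr
    _ = μ₁ * (t * (‖v‖ * ‖C₁‖)) + μ₂ * (t * (‖v‖ * ‖C₂‖)) + μ₃ * (t * (‖v‖ * ‖C₃‖)) + μ₄ * (t * (‖v‖ * ‖C₄‖)) := by ring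
    _ ≤ μ₁ * ⟪v, C₁⟫ + μ₂ * ⟪v, C₂⟫ + μ₃ * ⟪v, C₃⟫ + μ₄ * ⟪v, C₄⟫ := by gcongr

/-- ★ THE CAP OF A BOX: if `v` passes the integer cap test against the four corners of the box `(n, i, j)` on face `(ax, sg)`, then
`√(num/den)·‖v‖‖W‖ ≤ ⟪v, W⟫` for the real face vector `W = faceR ax (±2ⁿ) (2p₁2ⁿ − 2ⁿ) (2p₂2ⁿ − 2ⁿ)` of every point `p` of the box. [this file, g80] -/
theorem inner_ge_of_box {num den : ℕ} (hden : 0 < den) {v : Fin 3 → ℤ} {ax : Fin 3} {sg : Bool} {n : ℕ} {i j : ℤ}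
    (h : ∀ c ∈ corners ax sg n i j, capZB num den v c = true) {p : ℝ × ℝ} (hp : InBox n i j p) :
    Real.sqrt (num / den) * (‖intVec v‖ * ‖faceR ax (if sg then 2 ^ n else -2 ^ n) (2 * (p.1 * 2 ^ n) - 2 ^ n) (2 * (p.2 * 2 ^ n) - 2 ^ n)‖) ≤
      ⟪intVec v, faceR ax (if sg then 2 ^ n else -2 ^ n) (2 * (p.1 * 2 ^ n) - 2 ^ n) (2 * (p.2 * 2 ^ n) - 2 ^ n)⟫ := by
  obtain ⟨hx1, hx2, hy1, hy2⟩ := hp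
  have hc1 := inner_ge_of_capZB hden (h (faceZ ax (if sg then 2 ^ n else -2 ^ n) (2 * i - 2 ^ n) (2 * j - 2 ^ n)) (by simp [corners]))
  have hc2 := inner_ge_of_capZB hden (h (faceZ ax (if sg then 2 ^ n else -2 ^ n) (2 * i - 2 ^ n + 2) (2 * j - 2 ^ n)) (by simp [corners]))
  have hc3 := inner_ge_of_capZB hden (h (faceZ ax (if sg then 2 ^ n else -2 ^ n) (2 * i - 2 ^ n) (2 * j - 2 ^ n + 2)) (by simp [corners]))
  have hc4 := inner_ge_of_capZB hden
    (h (faceZ ax (if sg then 2 ^ n else -2 ^ n) (2 * i - 2 ^ n + 2) (2 * j - 2 ^ n + 2)) (by simp [corners]))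
  rw [intVec_faceZ] at hc1 hc2 hc3 hc4
  push_cast at hc1 hc2 hc3 hc4
  rw [faceR_bilinear ax _ (2 * i - 2 ^ n : ℝ) (2 * j - 2 ^ n : ℝ) _ _ (two_ne_zero)]
  exact inner_ge_of_cone4 (Real.sqrt_nonneg _) hc1 hc2 hc3 hc4 (div_nonneg (mul_nonneg (by linarith) (by linarith)) (sq_nonneg _))
    (div_nonneg (mul_nonneg (by linarith) (by linarith)) (sq_nonneg _)) (div_nonneg (mul_nonneg (by linarith) (by linarith)) (sq_nonneg _))
    (div_nonneg (mul_nonneg (by linarith) (by linarith)) (sq_nonneg _))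

end Summit.AtomisticToContinuum.Crystallization.Theorems.ChartedZeroExcessLayeredLatticeLiouville
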